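import Summits.ValiantsHypothesis.ValiantsHypothesis.Theorems.BarrierLeverPartitionMinorsHitByVPSplitDoor
import Summits.ValiantsHypothesis.ValiantsHypothesis.Theorems.BarrierLeverPartitionMinorsHitByVPSmallLayouts
import Summits.ValiantsHypothesis.ValiantsHypothesis.Theorems.BarrierLeverPartitionMinorsHitByVPProductStatesGeneral
import Summits.ValiantsHypothesis.ValiantsHypothesis.Theorems.BarrierLeverPartitionMinorsHitByVPOfLowerSets

/-!
# Route BarrierLever — item `PartitionMinorsHitByVP` (stmt-ValiantsHypothesis-19717):
# the CONE SPLIT and «ALL MINORS OF CO-RANK ≤ c», for every constant `c`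

Helper file (`--supports stmt-ValiantsHypothesis-19717`; cell valiant-natproofs, rung V4, 𝒟-side door
(c); prover seat val-np-p6 gen 7). Definition-free. Closes NO item.

**The cone split (`partitionMinor_hit_of_cones`).** Let `(v, w)` be an injective layout of `r` rows /
columns in `2^[h]` and `X, Y ⊆ [h]` with `|X| = |Y|` such that EVERY subset of `[h]` not containing `X`
is a row and every subset not containing `Y` is a column (equivalently: all missing rows contain `X`, all
missing columns contain `Y`), and the cone over `X` is small: `2^{h−|X|} ≤ 2h`. Then the layout is hit in
`SmallCircuits ℂ (h+h) 4`. Proof = ONE application of the general split door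
(`SplitDoor.partitionMinor_hit_of_split`, valiant-natproofs-prover g6) along the bi-threshold
«`X ⊆ S`» / «`Y ⊆ T`» (weights = indicators of `X`, `Y`): the TOP cells (`{S ∋⊇ X}`, `{T ⊇ Y}`, at most
`2h` members) are hit by the small-layout theorem (`ProductStateSums.partitionMinor_hit_of_card_le`), the
BOTTOM cells (`{S ⊉ X}` = ALL such subsets, `{T ⊉ Y}`) by the permutation witness `∏_a (1 + x_a y_{π a})`
for a permutation `π` of `[h]` with `π(X) = Y` (its partition matrix is the permutation `T = π(S)`, which
maps the bottom row cell onto the bottom column cell; `coeff_permWitness`).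

**Co-rank (companion file `…PartitionMinorsHitByVPCorankConst`: `partitionMinor_hit_lowerSets_of_corank_le`,
`partitionMinor_hit_of_corank_le`).** If
`Δ ⊆ 2^[h]` is a lower set missing only `c' ≤ c` subsets, every missing set `m` has all its `2^{h−|m|}`
supersets missing, so `|[h] ∖ m| < c`, the union of the complements of the missing sets has `< c²`
elements, and its complement `X₀` (`|X₀| ≥ h − c²`) lies inside every missing set (`exists_cone_of_corank_le`).
With `|X| = |Y| = h − c²` the cone split applies as soon as `2^{c²} ≤ 2h`; val-np-p1 g12's witness-agnostic
lower-set reduction (`DownCompression.exists_witness_of_lowerSets`) and truncation transfer this to EVERY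
injective layout: **for `h ≥ 4`, `c² ≤ h`, `2^{c²} ≤ 2h` and `r + c ≥ 2^h`, every injective layout of
size `r` is hit in `SmallCircuits ℂ (h+h) 9`** — all partition minors of co-rank `≤ c`, for every constant
`c`, eventually in `h` (`partitionMinor_hit_of_corank_le_eventually`). val-np-p6 g6 had co-rank `≤ 3`
(`FrobeniusDoor.partitionMinor_hit_of_corank_le_three`, via pairwise-isomorphic lower sets and the
same-pattern Frobenius door); the cone split needs no isomorphism and no table.

WHAT THIS IS NOT: a bounded-co-rank class; nothing on the middle range of `r`, on crux
stmt-ValiantsHypothesis-14610 or on `VP ≠ VNP`.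
-/

set_option linter.dupNamespace false

namespace Summit.ValiantsHypothesis.ValiantsHypothesis.Theorems.BarrierLever.ConeSplit

open Finset MvPolynomial
open Literature.Barriers.ValiantsHypothesis Literature.Computability.AlgebraicComplexity
open Summit.ValiantsHypothesis.ValiantsHypothesis.Theorems.BarrierLever.SplitDoor (partitionMinor_hit_of_split)
open Summit.ValiantsHypothesis.ValiantsHypothesis.Theorems.BarrierLever.ProductStateSums
  (partitionMinor_hit_of_card_le)
open Summit.ValiantsHypothesis.ValiantsHypothesis.Theorems.BarrierLever.ProductStatesC
  (coeff_prodStateC totalDegree_prodStateC_le complexity_prodStateC_le)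
open Summit.ValiantsHypothesis.ValiantsHypothesis.Theorems.BarrierLever.DownCompression
  (exists_witness_of_lowerSets size_le_pow)
open Summit.ValiantsHypothesis.ValiantsHypothesis.Theorems.BarrierLever.AdditiveDoor
  (truncation_spec degree_partitionExpo_le)

noncomputable section

variable {h : ℕ}

/-! ## 1. The permutation witness `∏_a (1 + x_a y_{π a})` -/

/-- **Coefficients of the permutation witness**: `coeff_{x^U y^W} ∏_a (1 + x_a y_{π a}) = [W = π(U)]`. -/
theorem coeff_permWitness (π : Equiv.Perm (Fin h)) (U W : Finset (Fin h)) :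
    coeff (∑ a ∈ U, Finsupp.single (Fin.castAdd h a) 1 + ∑ c ∈ W, Finsupp.single (Fin.natAdd h c) 1)
      (∏ a, ∑ p : Bool × Bool, C (if p.1 = p.2 then (1 : ℂ) else 0) *
        X (Fin.castAdd h a) ^ p.1.toNat * X (Fin.natAdd h (π a)) ^ p.2.toNat :
          MvPolynomial (Fin (h + h)) ℂ) =
      if W = U.map π.toEmbedding then 1 else 0 := by
  have hc := coeff_prodStateC (fun (_ : Fin h) (s t : Bool) => if s = t then (1 : ℂ) else 0) π U W
  rw [hc, Finset.prod_boole]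
  have key : (∀ a ∈ (Finset.univ : Finset (Fin h)), decide (a ∈ U) = decide (π a ∈ W)) ↔
      W = U.map π.toEmbedding := by
    constructor
    · intro hall
      ext b
      rw [Finset.mem_map_equiv]
      have hb := hall (π.symm b) (Finset.mem_univ _)
      rw [Equiv.apply_symm_apply] at hb
      constructor
      · intro hbW
        have h1 : decide (b ∈ W) = true := decide_eq_true hbW
        rw [← hb] at h1
        exact of_decide_eq_true h1
      · intro hbU
        have h1 : decide (π.symm b ∈ U) = true := decide_eq_true hbU
        rw [hb] at h1
        exact of_decide_eq_true h1
    · rintro rfl a -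
      by_cases ha : a ∈ U
      · have : π a ∈ U.map π.toEmbedding := by
          rw [Finset.mem_map_equiv, Equiv.symm_apply_apply]; exact ha
        rw [decide_eq_true ha, decide_eq_true this]
      · have : π a ∉ U.map π.toEmbedding := by
          rw [Finset.mem_map_equiv, Equiv.symm_apply_apply]; exact ha
        rw [decide_eq_false ha, decide_eq_false this]
  by_cases hW : W = U.map π.toEmbedding
  · rw [if_pos (key.mpr hW), if_pos hW]
  · rw [if_neg (fun hall => hW (key.mp hall)), if_neg hW]

/-- The permutation witness lies in `SmallCircuits ℂ (h+h) 3` (`h ≥ 4`): degree `≤ 2h`, size `≤ 13h`. -/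
theorem permWitness_mem (hh : 4 ≤ h) (π : Equiv.Perm (Fin h)) :
    (∏ a, ∑ p : Bool × Bool, C (if p.1 = p.2 then (1 : ℂ) else 0) *
        X (Fin.castAdd h a) ^ p.1.toNat * X (Fin.natAdd h (π a)) ^ p.2.toNat :
          MvPolynomial (Fin (h + h)) ℂ) ∈ SmallCircuits ℂ (h + h) 3 := by
  have hd := totalDegree_prodStateC_le (fun (_ : Fin h) (s t : Bool) => if s = t then (1 : ℂ) else 0) π
  have hs := complexity_prodStateC_le (fun (_ : Fin h) (s t : Bool) => if s = t then (1 : ℂ) else 0) π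
  refine ⟨hd, hs.trans ?_⟩
  calc 13 * h ≤ (h + h) * (h + h) * 1 := by nlinarith
    _ ≤ (h + h) * (h + h) * (h + h) := Nat.mul_le_mul_left _ (by omega)
    _ = (h + h) ^ 3 := by ring

/-! ## 2. Thresholds by the indicator weight of a set; permutations carrying `A` onto `B` -/

/-- The threshold `|A| − 1 < Σ_{a ∈ S} [a ∈ A]` holds exactly when `A ⊆ S`. -/
theorem threshold_iff (A S : Finset (Fin h)) :
    ((A.card : ℤ) - 1 < ∑ a ∈ S, (if a ∈ A then (1 : ℤ) else 0)) ↔ A ⊆ S := by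
  rw [Finset.sum_boole, Finset.filter_mem_eq_inter]
  constructor
  · intro hlt
    have hle : A.card ≤ (S ∩ A).card := by
      have : (A.card : ℤ) ≤ ((S ∩ A).card : ℤ) := by omega
      exact_mod_cast this
    have heq : S ∩ A = A := Finset.eq_of_subset_of_card_le Finset.inter_subset_right hle
    exact heq ▸ Finset.inter_subset_left
  · intro hAS
    have : S ∩ A = A := Finset.inter_eq_right.mpr hAS
    rw [this]; omega

/-- Indicator thresholds exist: some integer weight and cut-off select exactly the supersets of `A`. -/
theorem exists_threshold (A : Finset (Fin h)) :
    ∃ (lam : Fin h → ℤ) (cu : ℤ), ∀ S : Finset (Fin h), (cu < ∑ a ∈ S, lam a) ↔ A ⊆ S :=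
  ⟨fun a => if a ∈ A then 1 else 0, (A.card : ℤ) - 1, threshold_iff A⟩

/-- Two subsets of `Fin h` of the same size are exchanged by a permutation. -/
theorem exists_perm_map_eq (A B : Finset (Fin h)) (hAB : A.card = B.card) :
    ∃ π : Equiv.Perm (Fin h), A.map π.toEmbedding = B := by
  classical
  obtain ⟨eAB⟩ : Nonempty ({a : Fin h // a ∈ A} ≃ {a : Fin h // a ∈ B}) := by
    refine Fintype.card_eq.mp ?_
    rw [Fintype.card_coe, Fintype.card_coe, hAB]
  refine ⟨eAB.extendSubtype, ?_⟩
  ext b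
  rw [Finset.mem_map_equiv]
  constructor
  · intro hb
    have := eAB.extendSubtype_mem (eAB.extendSubtype.symm b) hb
    rwa [Equiv.apply_symm_apply] at this
  · intro hb
    obtain ⟨⟨a, ha⟩, hab⟩ := eAB.surjective ⟨b, hb⟩
    have h1 : eAB.extendSubtype a = b := by
      rw [eAB.extendSubtype_apply_of_mem a ha, hab]
    rw [← h1, Equiv.symm_apply_apply]
    exact ha

/-! ## 3. The cone split -/

/-- **THE CONE SPLIT.** If every subset of `[h]` not containing `A` is a row of the injective layout
`v`, every subset not containing `B` is a column of `w`, `|A| = |B|`, and `2^{h − |A|} ≤ 2h` (`h ≥ 4`), then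
the layout is hit in `SmallCircuits ℂ (h+h) 4`. -/
theorem partitionMinor_hit_of_cones {r : ℕ} (hh : 4 ≤ h) (v w : Fin r → Finset (Fin h))
    (hv : Function.Injective v) (hw : Function.Injective w) (A B : Finset (Fin h))
    (hAB : A.card = B.card) (hsmall : 2 ^ (h - A.card) ≤ h + h)
    (hA : ∀ S : Finset (Fin h), S ∉ Set.range v → A ⊆ S)
    (hB : ∀ T : Finset (Fin h), T ∉ Set.range w → B ⊆ T) :
    ∃ f ∈ SmallCircuits ℂ (h + h) 4,
      (Matrix.of fun i j : Fin r => MvPolynomial.coeff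
        (∑ a ∈ v i, Finsupp.single (Fin.castAdd h a) 1 +
          ∑ c ∈ w j, Finsupp.single (Fin.natAdd h c) 1) f).det ≠ 0 := by
  classical
  -- the bi-threshold selecting the cones over `A` and `B`
  obtain ⟨lam, cu, hP⟩ := exists_threshold A
  obtain ⟨mu, cw, hQ⟩ := exists_threshold B
  -- a permutation of `[h]` carrying `A` onto `B`
  obtain ⟨π, hπA⟩ := exists_perm_map_eq A B hAB
  have hmapB : ∀ S : Finset (Fin h), B ⊆ S.map π.toEmbedding → A ⊆ S := by
    intro S hBS a ha
    have : π a ∈ S.map π.toEmbedding :=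
      hBS (by rw [← hπA, Finset.mem_map_equiv, Equiv.symm_apply_apply]; exact ha)
    rwa [Finset.mem_map_equiv, Equiv.symm_apply_apply] at this
  have hmapA : ∀ T : Finset (Fin h), A ⊆ T.map π.symm.toEmbedding → B ⊆ T := by
    intro T hAT b hb
    have hb' : π.symm b ∈ A := by
      rw [← hπA, Finset.mem_map_equiv] at hb; exact hb
    have : π.symm b ∈ T.map π.symm.toEmbedding := hAT hb'
    rwa [Finset.mem_map_equiv, Equiv.symm_symm, Equiv.apply_symm_apply] at this
  have hmap_symm : ∀ S : Finset (Fin h), (S.map π.toEmbedding).map π.symm.toEmbedding = S := by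
    intro S; ext a
    rw [Finset.mem_map_equiv, Finset.mem_map_equiv, Equiv.symm_symm, Equiv.symm_apply_apply]
  have hmap_symm' : ∀ T : Finset (Fin h), (T.map π.symm.toEmbedding).map π.toEmbedding = T := by
    intro T; ext a
    rw [Finset.mem_map_equiv, Finset.mem_map_equiv, Equiv.symm_symm, Equiv.apply_symm_apply]
  -- the bottom bijection `e'`: row `S ⊉ A` ↦ the column `π(S)`
  have hex : ∀ i : {i : Fin r // ¬ cu < ∑ a ∈ v i, lam a},
      ∃ j : {j : Fin r // ¬ cw < ∑ c ∈ w j, mu c}, w j.1 = (v i.1).map π.toEmbedding := by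
    intro i
    have hT : (v i.1).map π.toEmbedding ∈ Set.range w := by
      by_contra hT
      exact i.2 ((hP _).mpr (hmapB _ (hB _ hT)))
    obtain ⟨j, hj⟩ := hT
    refine ⟨⟨j, fun hj' => i.2 ((hP _).mpr (hmapB _ ?_))⟩, hj⟩
    rw [← hj]; exact (hQ _).mp hj'
  have hex' : ∀ j : {j : Fin r // ¬ cw < ∑ c ∈ w j, mu c},
      ∃ i : {i : Fin r // ¬ cu < ∑ a ∈ v i, lam a}, v i.1 = (w j.1).map π.symm.toEmbedding := by
    intro j
    have hS : (w j.1).map π.symm.toEmbedding ∈ Set.range v := by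
      by_contra hS
      exact j.2 ((hQ _).mpr (hmapA _ (hA _ hS)))
    obtain ⟨i, hi⟩ := hS
    refine ⟨⟨i, fun hi' => j.2 ((hQ _).mpr (hmapA _ ?_))⟩, hi⟩
    rw [← hi]; exact (hP _).mp hi'
  choose g hg using hex
  choose g' hg' using hex'
  have hgl : Function.LeftInverse g' g := fun i => by
    apply Subtype.ext
    apply hv
    rw [hg', hg, hmap_symm]
  have hgr : Function.RightInverse g' g := fun j => by
    apply Subtype.ext
    apply hw
    rw [hg, hg', hmap_symm']
  let e' : {i : Fin r // ¬ cu < ∑ a ∈ v i, lam a} ≃ {j : Fin r // ¬ cw < ∑ c ∈ w j, mu c} :=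
    ⟨g, g', hgl, hgr⟩
  have he' : ∀ i, w (e' i).1 = (v i.1).map π.toEmbedding := hg
  -- the top bijection `e` from cardinalities
  have hcard_top : Fintype.card {i : Fin r // cu < ∑ a ∈ v i, lam a} =
      Fintype.card {j : Fin r // cw < ∑ c ∈ w j, mu c} := by
    have h0 := Fintype.card_congr e'
    have h1 := Fintype.card_subtype_compl (fun i : Fin r => cu < ∑ a ∈ v i, lam a)
    have h2 := Fintype.card_subtype_compl (fun j : Fin r => cw < ∑ c ∈ w j, mu c)
    have h3 : Fintype.card {i : Fin r // cu < ∑ a ∈ v i, lam a} ≤ Fintype.card (Fin r) :=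
      Fintype.card_subtype_le _
    have h4 : Fintype.card {j : Fin r // cw < ∑ c ∈ w j, mu c} ≤ Fintype.card (Fin r) :=
      Fintype.card_subtype_le _
    omega
  obtain ⟨e⟩ : Nonempty ({i : Fin r // cu < ∑ a ∈ v i, lam a} ≃ {j : Fin r // cw < ∑ c ∈ w j, mu c}) :=
    Fintype.card_eq.mp hcard_top
  -- the top cell is small: at most `2^{h - |A|} ≤ 2h` rows
  have hr₁le : Fintype.card {i : Fin r // cu < ∑ a ∈ v i, lam a} ≤ (h + h) ^ 1 := by
    rw [pow_one]
    refine le_trans ?_ hsmall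
    have hinj : Function.Injective (fun i : {i : Fin r // cu < ∑ a ∈ v i, lam a} => v i.1 \ A) := by
      intro i i' hii'
      apply Subtype.ext
      apply hv
      have hi := (hP _).mp i.2
      have hi' := (hP _).mp i'.2
      have key : v i.1 \ A ∪ A = v i'.1 \ A ∪ A := by
        show (fun i : {i : Fin r // cu < ∑ a ∈ v i, lam a} => v i.1 \ A) i ∪ A = _ ∪ A
        rw [hii']
      rwa [Finset.sdiff_union_of_subset hi, Finset.sdiff_union_of_subset hi'] at key
    have hmem : ∀ i ∈ (Finset.univ : Finset {i : Fin r // cu < ∑ a ∈ v i, lam a}),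
        (fun i : {i : Fin r // cu < ∑ a ∈ v i, lam a} => v i.1 \ A) i ∈ (Finset.univ \ A).powerset :=
      fun i _ => Finset.mem_powerset.mpr (Finset.sdiff_subset_sdiff (Finset.subset_univ _) le_rfl)
    calc Fintype.card {i : Fin r // cu < ∑ a ∈ v i, lam a}
        = (Finset.univ : Finset {i : Fin r // cu < ∑ a ∈ v i, lam a}).card := Finset.card_univ.symm
      _ ≤ ((Finset.univ \ A).powerset).card := Finset.card_le_card_of_injOn _ hmem hinj.injOn
      _ = 2 ^ (h - A.card) := by
          rw [Finset.card_powerset, ← Finset.compl_eq_univ_sdiff, Finset.card_compl, Fintype.card_fin]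
  -- the top cell, re-indexed by `Fin r₁`, is hit by the small-layout theorem
  obtain ⟨ε⟩ : Nonempty ({i : Fin r // cu < ∑ a ∈ v i, lam a} ≃
      Fin (Fintype.card {i : Fin r // cu < ∑ a ∈ v i, lam a})) := ⟨Fintype.equivFin _⟩
  obtain ⟨f₁, hf₁, hdet₁⟩ := partitionMinor_hit_of_card_le 1 h hh _ hr₁le
    (fun k => v (ε.symm k).1) (fun k => w (e (ε.symm k)).1)
    (fun k k' hk => ε.symm.injective (Subtype.ext (hv hk)))
    (fun k k' hk => ε.symm.injective (e.injective (Subtype.ext (hw hk))))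
  -- the split door: top cell by `f₁`, bottom cell by the permutation witness
  refine partitionMinor_hit_of_split h r 3 (by omega) (by norm_num) v w lam mu cu cw e e' f₁ _
    hf₁ (permWitness_mem hh π) ?_ ?_
  · -- top cell
    have hre : (Matrix.of fun i i' : {i : Fin r // cu < ∑ a ∈ v i, lam a} => MvPolynomial.coeff
        (∑ a ∈ v i.1, Finsupp.single (Fin.castAdd h a) 1 +
          ∑ c ∈ w (e i').1, Finsupp.single (Fin.natAdd h c) 1) f₁) =
        Matrix.reindex ε.symm ε.symm (Matrix.of fun k k' :
          Fin (Fintype.card {i : Fin r // cu < ∑ a ∈ v i, lam a}) => MvPolynomial.coeff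
          (∑ a ∈ v (ε.symm k).1, Finsupp.single (Fin.castAdd h a) 1 +
            ∑ c ∈ w (e (ε.symm k')).1, Finsupp.single (Fin.natAdd h c) 1) f₁) := by
      ext i i'
      simp only [Matrix.reindex_apply, Matrix.submatrix_apply, Matrix.of_apply, Equiv.symm_symm,
        Equiv.symm_apply_apply]
    rw [hre, Matrix.det_reindex_self]
    exact hdet₁
  · -- bottom cell: the identity matrix
    have hone : (Matrix.of fun i i' : {i : Fin r // ¬ cu < ∑ a ∈ v i, lam a} => MvPolynomial.coeff
        (∑ a ∈ v i.1, Finsupp.single (Fin.castAdd h a) 1 +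
          ∑ c ∈ w (e' i').1, Finsupp.single (Fin.natAdd h c) 1)
        (∏ a, ∑ p : Bool × Bool, C (if p.1 = p.2 then (1 : ℂ) else 0) *
          X (Fin.castAdd h a) ^ p.1.toNat * X (Fin.natAdd h (π a)) ^ p.2.toNat :
            MvPolynomial (Fin (h + h)) ℂ)) = 1 := by
      ext i i'
      rw [Matrix.of_apply, coeff_permWitness, Matrix.one_apply, he' i']
      by_cases hii' : i = i'
      · subst hii'; simp
      · have hne : (v i'.1).map π.toEmbedding ≠ (v i.1).map π.toEmbedding := by
          intro heq
          apply hii'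
          apply Subtype.ext
          apply hv
          have := congrArg (fun S => S.map π.symm.toEmbedding) heq
          simp only [hmap_symm] at this
          exact this.symm
        rw [if_neg hne, if_neg hii']
    rw [hone, Matrix.det_one]
    exact one_ne_zero

end

end Summit.ValiantsHypothesis.ValiantsHypothesis.Theorems.BarrierLever.ConeSplit
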